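import Summits.BirchSwinnertonDyer.Rank1Residual.Additive.CensusX42BSDMult
import Summits.BirchSwinnertonDyer.Rank1Residual.Additive.CensusQ6UnitCoeffCertificate
import HarnessLib

/-!
# Census records, rank one: the Q6 INTERLOCK on the (G-ord, `e = 2`) rows — a census Q6 record with
# first unit index `n₀ = 1` IS additive-p2's one-number certificate `BranchUnitCertificateAt W p` when
# `L(E,1) = 0` — and the TWO-RECORD node: Q6 record `n₀ = 1` + census relation X4-2 AT THE PAIR +
# Kato's (resp. the (M)) divisibility + a (B)-datum ⟹ `BSD(E,p)` (cell `b2b-bsdres`, census cell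
# `bsd-formula-census`, seat `b2b-bsdres-census-ctyper1` = conjecture-typer 1, gen 3; H-9 / Q6 format
# p253484; H-13 `cells/n1011/PREDICTIONS-KURREG.md` §1 (c1) "n₀ = 1 ∧ c₀ = 0")

HONEST FRAMING (cell `b2b-bsdres`, run/shared/lean/b2b/bsd-rank1-residual/, verbatim in every
file): the goal of the cell is to DELETE the COMBINATION-SHAPED residual classes of the
Birch–Swinnerton-Dyer formula for ALL analytic-rank `≤ 1` elliptic curves over `ℚ` — "full BSD
formula for every rank `≤ 1` curve in class `C`" assembled STRICTLY from published theorems — so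
that the rank-`≤ 1` remainder becomes exactly the CONSTRUCTION-SHAPED classes, which are TYPED
(missing-input `Prop`s), NOT attempted. This is not "finishing BSD". Census cell
(bsd-formula-census): research instrumentation; census output = EVIDENCE / conjecture items and
per-pair CERTIFICATE-EVIDENCE (instrumentation tier), never a Literature fact; labels / RESIDUAL-MAP
marks UNCHANGED (O7 OPEN); nothing booked. THEOREMS ONLY (no definition, no named fact); named facts
enter as HYPOTHESES (Kato 2004 Thm. 17.4 (3) `hK`, Pal 2012 Thm. 3.2 `hPal`, Delbourgo 2002 (B) via a
(B)-datum `hB`, modularity, GZK); the census inputs are HYPOTHESES: the Q6 record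
`CensusQ6.GordFirstUnitIndexAt W p 1` / `…Odd…` / `MultFirstUnitIndexAt W p 1` / `…Odd…`
(CERTIFICATE-EVIDENCE, two engines per PREDICTIONS-Q6) and the typed census relation
`CensusX42.RelationAt W p Dh` (CANDIDATE; X42-REPORT.md sha256
`e8592c9a2e1a59c13e754928288c9f6b1ce554f7ffb80b93db3c55aa7f5e9950`).

## What

n1011-p07 proved the (M) interlock `multBranchUnitCertificateAt_of_firstUnitIndex_one[_odd]`
(`PotMultRankOneKatoCertificateBSD.lean` §6): the census record "first `p`-adic unit coefficient of
the Néron-normalised branch at index `1`" + `L(E,1) = 0` ⟹ the rank-one certificate (constant term `0`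
by interpolation, additive-p2's `constantCoeff_…_of_entireLFunction_one_eq_zero`). §1 here is the
(G-ord, `e = 2`) twin: `branchUnitCertificateAt_of_gordFirstUnitIndexAt_one` (`p ≡ 1 (mod 4)`, record
`CensusQ6.GordFirstUnitIndexAt W p 1`) and `…_odd` (`p ≡ 3 (mod 4)`, `CensusQ6.GordOddFirstUnitIndexAt
W p 1`) ⟹ additive-p2's `BranchUnitCertificateAt W p`, via `branchUnitCertificateAt_of_norm_coeff_one`.
So on the Gord2 rows too the rank-`0` consumers (Q6 register, n1011-p06), H-13's column (c1) and the
rank-`1` chain share ONE certificate currency; and the census's X4-2 `v_p(A′) = 1` column (A′ =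
`ϖ·c_∞·[T¹]B·log_p γ`, `ord_p log_p γ = 1`, `c_∞` a unit) is the same bit. §2–§3: the TWO-RECORD node —
`ClassX4Gord.bsdp_of_censusX42_of_katoHalf_of_gordFirstUnitIndexAt_one[_odd]` and the (M) twins
`ClassX4M.bsdp_of_censusX42_of_katoHalf_of_multFirstUnitIndexAt_one[_odd]`: Q6 record `n₀ = 1` + the
census relation X4-2 AT THE PAIR + Kato half + a (B)-datum + `L'(E,1) = q·Ω_E·Reg_∞` ⟹ `BSD(E,p)`
(`CensusX42BSD.lean` / `CensusX42BSDMult.lean` fed by §1 / p07's interlock). EVIDENCE-conditional on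
both census inputs; nothing about any curve is asserted; nothing booked.

References: B. Mazur, J. Tate, J. Teitelbaum, Invent. Math. 84 (1986) §I.13 [MazurTateTeitelbaum1986Invent];
A. Pal, Proc. AMS 140 (2012) Thm. 3.2 [Pal2012]; K. Kato, Astérisque 295 (2004) Thm. 17.4 (3)
[Kato2004Asterisque]; D. Delbourgo, J. Number Theory 95 (2002) Thm. (B) [Delbourgo2002]; R. L. Miller,
LMS J. Comput. Math. 14 (2011) Def. 1.1 [Miller2011LMS]; HOME/cells/n1011/PREDICTIONS-Q6.md,
PREDICTIONS-KURREG.md §1/§3 (registers; EVIDENCE).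
-/

noncomputable section

open scoped Classical MatrixGroups ModularForm NumberField

namespace Summit.BirchSwinnertonDyer.Rank1Residual.Additive

open CongruenceSubgroup WeierstrassCurve NumberField Literature.NumberTheory.EllipticCurves
  Literature.NumberTheory.EllipticCurves.ModularForms
  Literature.NumberTheory.EllipticCurves.Rank1Residual
  Literature.NumberTheory.EllipticCurves.Rank1Residual.Typed
  Literature.NumberTheory.EllipticCurves.Delbourgo2002
  Literature.NumberTheory.GaloisRepresentations Summit.BirchSwinnertonDyer.Rank1Residual.AdditivePotMult
  IsDedekindDomain

variable {W : WeierstrassCurve ℚ} [W.IsElliptic] [W.IsGloballyMinimal] {p : ℕ} [hp : Fact p.Prime]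

/-! ### §1 The Q6 interlock on (G-ord, `e = 2`): record `n₀ = 1` + `L(E,1) = 0` ⟹ the certificate -/

/-- **Q6 INTERLOCK, (G-ord), even branch (`p ≡ 1 (mod 4)`)**: census-ctyper1's record
`CensusQ6.GordFirstUnitIndexAt W p 1` ("the first `p`-adic unit coefficient of
`ϖ·L_p(f♭, α♭, ω^{(p−1)/2}, T)` sits at index `1`") and `L(E,1) = 0` ⟹ additive-p2's
`BranchUnitCertificateAt W p` (the constant term `0` by interpolation — Birch + Pal `hPal`). So the
rank-`0` consumers, the Q6 register, H-13's column (c1) and the rank-`1` chain share ONE certificate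
currency on Gord2. [cite: MazurTateTeitelbaum1986Invent, §I.13] [cite: Pal2012, Thm. 3.2] -/
theorem branchUnitCertificateAt_of_gordFirstUnitIndexAt_one
    (hPal : Pal2012.thm32_sqrt_mul_realPeriodRat_twist_eq_of_prime_one_mod_four)
    (hmod : hasEntireLFunction_rat) (hp4 : p % 4 = 1) (hadd : Addv W p) (hL : W.entireLFunction 1 = 0)
    (hrec : CensusQ6.GordFirstUnitIndexAt W p 1) : BranchUnitCertificateAt W p := by
  have hp2 : p ≠ 2 := by omega
  have heven : Even (p / 2) := ⟨p / 4, by omega⟩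
  refine branchUnitCertificateAt_of_norm_coeff_one hPal hmod hp2 hadd hL ?_
  intro V _ _ C hC hord N _ f hf ϖ hϖ
  have hC' : C • V.quadraticTwist (p : ℚ) = W := by
    rw [pStar_eq_self_of_mod_four_eq_one hp4] at hC; exact hC
  rw [if_pos heven] at hϖ ⊢
  exact (hrec V C hord hC' f hf ϖ hϖ).2

/-- **Q6 INTERLOCK, (G-ord), odd branch (`p ≡ 3 (mod 4)`)**: `CensusQ6.GordOddFirstUnitIndexAt W p 1`
and `L(E,1) = 0` ⟹ `BranchUnitCertificateAt W p` (Pal for `d < 0` is a tree theorem; `hPal` is only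
carried for the uniform signature of `branchUnitCertificateAt_of_norm_coeff_one`).
[cite: MazurTateTeitelbaum1986Invent, §I.13] -/
theorem branchUnitCertificateAt_of_gordFirstUnitIndexAt_one_odd
    (hPal : Pal2012.thm32_sqrt_mul_realPeriodRat_twist_eq_of_prime_one_mod_four)
    (hmod : hasEntireLFunction_rat) (hp4 : p % 4 = 3) (hadd : Addv W p) (hL : W.entireLFunction 1 = 0)
    (hrec : CensusQ6.GordOddFirstUnitIndexAt W p 1) : BranchUnitCertificateAt W p := by
  have hp2 : p ≠ 2 := by omega
  have hodd : ¬ Even (p / 2) := by rw [Nat.not_even_iff_odd]; exact ⟨p / 4, by omega⟩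
  refine branchUnitCertificateAt_of_norm_coeff_one hPal hmod hp2 hadd hL ?_
  intro V _ _ C hC hord N _ f hf ϖ hϖ
  have hC' : C • V.quadraticTwist (-(p : ℚ)) = W := by
    rw [pStar_eq_neg_of_mod_four_eq_three hp4] at hC; exact hC
  rw [if_neg hodd] at hϖ ⊢
  exact (hrec V C hord hC' f hf ϖ hϖ).2

/-! ### §2 TWO census records at the pair ⟹ `BSD(E,p)` on X4♯(G-ord) ∩ `I₀*` ∩ {`ρ̄` onto} -/

/-- **TWO-RECORD NODE, (G-ord), `p ≡ 1 (mod 4)`, `p ≥ 5`, `r_an = 1`, non-anomalous:** the Q6 record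
`CensusQ6.GordFirstUnitIndexAt W p 1` (CERTIFICATE-EVIDENCE) + the typed census relation
`CensusX42.RelationAt W p Dh` (CANDIDATE) AT THE PAIR + Kato's component divisibility (`hK`) + Pal
(`hPal`) + modularity + GZK + a (B)-datum `Dh` + `L'(E,1) = q·Ω_E·Reg_∞` ⟹ `BSD(E,p)`
(`ClassX4Gord.bsdp_of_censusX42_of_katoHalf_of_cert` fed by §1). EVIDENCE-conditional; nothing booked.
[cite: Kato2004Asterisque, Thm. 17.4 (3) (p. 273)] [cite: Delbourgo2002, Theorem (B) (p. 40)]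
[cite: Pal2012, Thm. 3.2] [cite: Miller2011LMS, Def. 1.1] -/
theorem ClassX4Gord.bsdp_of_censusX42_of_katoHalf_of_gordFirstUnitIndexAt_one
    (hK : Wuthrich2014.kato_halfEigenCharIdeal_dvd_cyclotomicPrime_of_surjective)
    (hPal : Pal2012.thm32_sqrt_mul_realPeriodRat_twist_eq_of_prime_one_mod_four)
    (hmodD : nonempty_modularParametrizationData)
    (hGZK : rank_eq_analyticRank_of_analyticRank_le_one) (hmod : hasEntireLFunction_rat)
    (hX : ClassX4Gord W p) (hp5 : 5 ≤ p) (hp4 : p % 4 = 1) (he : semistabilityIndex W p = 2)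
    (hsurj : Surj W p) (hr : W.analyticRank = 1) (hna : ReductionNonAnomalous W p)
    (hrec : CensusQ6.GordFirstUnitIndexAt W p 1)
    {Dh : PAdicHeightData W p} (hB : LeadingTermClauses W p Dh) (hrel : CensusX42.RelationAt W p Dh)
    {q : ℚ} (hLq : W.leadingLCoeff = (q : ℂ) * (W.realPeriodRat : ℂ) * (W.regulator : ℂ)) :
    BSDp W p :=
  hX.bsdp_of_censusX42_of_katoHalf_of_cert hK hmodD hGZK hmod hp5 he hsurj hr hna
    (branchUnitCertificateAt_of_gordFirstUnitIndexAt_one hPal hmod hp4 hX.addv.2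
      (entireLFunction_one_eq_zero_of_analyticRank_ne_zero hmod (by rw [hr]; exact one_ne_zero)) hrec)
    hB hrel hLq

/-- **TWO-RECORD NODE, (G-ord), `p ≡ 3 (mod 4)`, `p ≥ 5`, `r_an = 1`, non-anomalous** (odd branch;
record `CensusQ6.GordOddFirstUnitIndexAt W p 1`). [cite: Kato2004Asterisque, Thm. 17.4 (3) (p. 273)]
[cite: Delbourgo2002, Theorem (B) (p. 40)] [cite: Miller2011LMS, Def. 1.1] -/
theorem ClassX4Gord.bsdp_of_censusX42_of_katoHalf_of_gordFirstUnitIndexAt_one_odd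
    (hK : Wuthrich2014.kato_halfEigenCharIdeal_dvd_cyclotomicPrime_of_surjective)
    (hPal : Pal2012.thm32_sqrt_mul_realPeriodRat_twist_eq_of_prime_one_mod_four)
    (hmodD : nonempty_modularParametrizationData)
    (hGZK : rank_eq_analyticRank_of_analyticRank_le_one) (hmod : hasEntireLFunction_rat)
    (hX : ClassX4Gord W p) (hp5 : 5 ≤ p) (hp4 : p % 4 = 3) (he : semistabilityIndex W p = 2)
    (hsurj : Surj W p) (hr : W.analyticRank = 1) (hna : ReductionNonAnomalous W p)
    (hrec : CensusQ6.GordOddFirstUnitIndexAt W p 1)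
    {Dh : PAdicHeightData W p} (hB : LeadingTermClauses W p Dh) (hrel : CensusX42.RelationAt W p Dh)
    {q : ℚ} (hLq : W.leadingLCoeff = (q : ℂ) * (W.realPeriodRat : ℂ) * (W.regulator : ℂ)) :
    BSDp W p :=
  hX.bsdp_of_censusX42_of_katoHalf_of_cert hK hmodD hGZK hmod hp5 he hsurj hr hna
    (branchUnitCertificateAt_of_gordFirstUnitIndexAt_one_odd hPal hmod hp4 hX.addv.2
      (entireLFunction_one_eq_zero_of_analyticRank_ne_zero hmod (by rw [hr]; exact one_ne_zero)) hrec)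
    hB hrel hLq

/-- **TWO-RECORD NODE on the `#Ш_an`-UNIT rows (no non-anomalous binder), `p ≡ 1 (mod 4)`:** Q6 record
`n₀ = 1` + census relation at the pair + Kato half + a (B)-datum + `#Ш_an = s`, `ord_p s = 0` ⟹
`BSD(E,p)` (and `ℓ = 1` in the exact identity; `…_of_shaAn_unit`). [cite: Kato2004Asterisque, Thm. 17.4 (3) (p. 273)]
[cite: Delbourgo2002, Theorem (B) (p. 40)] [cite: Miller2011LMS, Def. 1.1] -/
theorem ClassX4Gord.bsdp_of_censusX42_of_katoHalf_of_gordFirstUnitIndexAt_one_of_shaAn_unit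
    (hK : Wuthrich2014.kato_halfEigenCharIdeal_dvd_cyclotomicPrime_of_surjective)
    (hPal : Pal2012.thm32_sqrt_mul_realPeriodRat_twist_eq_of_prime_one_mod_four)
    (hmodD : nonempty_modularParametrizationData)
    (hGZK : rank_eq_analyticRank_of_analyticRank_le_one) (hmod : hasEntireLFunction_rat)
    (hX : ClassX4Gord W p) (hp5 : 5 ≤ p) (hp4 : p % 4 = 1) (he : semistabilityIndex W p = 2)
    (hsurj : Surj W p) (hr : W.analyticRank = 1) (hrec : CensusQ6.GordFirstUnitIndexAt W p 1)
    {Dh : PAdicHeightData W p} (hB : LeadingTermClauses W p Dh) (hrel : CensusX42.RelationAt W p Dh)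
    {s : ℚ} (hs : shaAn W = (s : ℂ)) (hsv : padicValRat p s = 0) : BSDp W p :=
  (hX.bsdp_of_censusX42_of_katoHalf_of_cert_of_shaAn_unit hK hmodD hGZK hmod hp5 he hsurj hr
    (branchUnitCertificateAt_of_gordFirstUnitIndexAt_one hPal hmod hp4 hX.addv.2
      (entireLFunction_one_eq_zero_of_analyticRank_ne_zero hmod (by rw [hr]; exact one_ne_zero)) hrec)
    hB hrel hs hsv).1

end Summit.BirchSwinnertonDyer.Rank1Residual.Additive

/-! ### §3 (M) rows: p07's interlock + the (M) one-node theorem -/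

namespace Summit.BirchSwinnertonDyer.Rank1Residual.AdditivePotMult

open CongruenceSubgroup WeierstrassCurve NumberField Literature.NumberTheory.EllipticCurves
  Literature.NumberTheory.EllipticCurves.ModularForms
  Literature.NumberTheory.EllipticCurves.Rank1Residual
  Literature.NumberTheory.EllipticCurves.Rank1Residual.Typed
  Literature.NumberTheory.EllipticCurves.Delbourgo2002
  Literature.NumberTheory.GaloisRepresentations
  Summit.BirchSwinnertonDyer.Rank1Residual.Additive
  IsDedekindDomain

variable {W : WeierstrassCurve ℚ} [W.IsElliptic] [W.IsGloballyMinimal] {p : ℕ} [hp : Fact p.Prime]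

/-- **TWO-RECORD NODE on (M), `p ≡ 1 (mod 4)`, big image, `r_an = 1`:** the Q6 record
`CensusQ6.MultFirstUnitIndexAt W p 1` + the typed census relation `CensusX42.RelationAt W p Dh` AT THE
PAIR + Kato's half-eigen divisibility + Pal + modularity + GZK + a (B)-datum + `L'(E,1) = q·Ω_E·Reg_∞`
⟹ `BSD(E,p)` (p07's `multBranchUnitCertificateAt_of_firstUnitIndex_one` ∘
`ClassX4M.bsdp_of_censusX42_of_katoHalf_of_multCert`). EVIDENCE-conditional; nothing booked.
[cite: Kato2004Asterisque, Thm. 17.4 (3) (p. 273)] [cite: Delbourgo2002, Theorem (B) (p. 40)]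
[cite: Pal2012, Thm. 3.2] [cite: Miller2011LMS, Def. 1.1] -/
theorem ClassX4M.bsdp_of_censusX42_of_katoHalf_of_multFirstUnitIndexAt_one
    (hK : Wuthrich2014.kato_halfEigenCharIdeal_dvd_cyclotomicPrime_of_surjective)
    (hPal : Pal2012.thm32_sqrt_mul_realPeriodRat_twist_eq_of_prime_one_mod_four)
    (hmodD : nonempty_modularParametrizationData)
    (hGZK : rank_eq_analyticRank_of_analyticRank_le_one) (hmod : hasEntireLFunction_rat)
    (hX : ClassX4M W p) (hp4 : p % 4 = 1) (hsurj : Surj W p) (hr : W.analyticRank = 1)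
    (hrec : CensusQ6.MultFirstUnitIndexAt W p 1)
    {Dh : PAdicHeightData W p} (hB : LeadingTermClauses W p Dh) (hrel : CensusX42.RelationAt W p Dh)
    {q : ℚ} (hLq : W.leadingLCoeff = (q : ℂ) * (W.realPeriodRat : ℂ) * (W.regulator : ℂ)) :
    BSDp W p :=
  hX.bsdp_of_censusX42_of_katoHalf_of_multCert hK hmodD hGZK hmod hsurj hr
    (multBranchUnitCertificateAt_of_firstUnitIndex_one hPal hmod hp4 hX.classX4.2.1
      (entireLFunction_one_eq_zero_of_analyticRank_ne_zero hmod (by rw [hr]; exact one_ne_zero)) hrec)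
    hB hrel hLq

/-- **TWO-RECORD NODE on (M), `p ≡ 3 (mod 4)` (`p = 3` included), big image, `r_an = 1`** (odd
branch; record `CensusQ6.MultOddFirstUnitIndexAt W p 1` — p07's (M)@3 CENSUS HOOK).
[cite: Kato2004Asterisque, Thm. 17.4 (3) (p. 273)] [cite: Delbourgo2002, Theorem (B) (p. 40)]
[cite: Miller2011LMS, Def. 1.1] -/
theorem ClassX4M.bsdp_of_censusX42_of_katoHalf_of_multFirstUnitIndexAt_one_odd
    (hK : Wuthrich2014.kato_halfEigenCharIdeal_dvd_cyclotomicPrime_of_surjective)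
    (hPal : Pal2012.thm32_sqrt_mul_realPeriodRat_twist_eq_of_prime_one_mod_four)
    (hmodD : nonempty_modularParametrizationData)
    (hGZK : rank_eq_analyticRank_of_analyticRank_le_one) (hmod : hasEntireLFunction_rat)
    (hX : ClassX4M W p) (hp4 : p % 4 = 3) (hsurj : Surj W p) (hr : W.analyticRank = 1)
    (hrec : CensusQ6.MultOddFirstUnitIndexAt W p 1)
    {Dh : PAdicHeightData W p} (hB : LeadingTermClauses W p Dh) (hrel : CensusX42.RelationAt W p Dh)
    {q : ℚ} (hLq : W.leadingLCoeff = (q : ℂ) * (W.realPeriodRat : ℂ) * (W.regulator : ℂ)) :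
    BSDp W p :=
  hX.bsdp_of_censusX42_of_katoHalf_of_multCert hK hmodD hGZK hmod hsurj hr
    (multBranchUnitCertificateAt_of_firstUnitIndex_one_odd hPal hmod hp4 hX.classX4.2.1
      (entireLFunction_one_eq_zero_of_analyticRank_ne_zero hmod (by rw [hr]; exact one_ne_zero)) hrec)
    hB hrel hLq

end Summit.BirchSwinnertonDyer.Rank1Residual.AdditivePotMult

end
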